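import Mathlib.Analysis.Fourier.AddCircle
import Mathlib.Analysis.SpecialFunctions.Integrals.Basic
import HarnessLib

/-!
# Parseval for the Neumann cosine modes of an interval, and the diagonalisation of the Neumann form

Topic `Literature/MathematicalPhysics/QuantumManyBody`, grouping namespace `NeumannBox` (provefact
`Literature.MathematicalPhysics.QuantumManyBody.BoseGas.Junge2026_neumannBox_pinnedLowerBound`;
companion of `NeumannBoxEigenbasis.lean`, the normalised Neumann eigenbasis
`u_p = |Λ|^{-1/2}∏ c_{pᵢ}cos(pᵢxᵢ)` of [FournaisEtAl2024, (2.20)]). The momentum cut-offs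
`Q^L = 1_{𝒫_L}(√-Δ)`, `Q^H` and the spectral gaps of [FournaisEtAl2024, §2.3] rest on two facts
about the one-dimensional factors `cos(nπx/ℓ)`, `n ≥ 0`, on `(0, ℓ)`: they are COMPLETE in `L²(0,ℓ)`,
and the Neumann form `∫₀^ℓ |f'|²` — with NO boundary condition on `f` — is diagonal in them with
eigenvalues `(nπ/ℓ)²`. Both are proved here, for continuous (resp. `C¹`) complex `f`, from
Mathlib's Parseval identity on the circle (`hasSum_sq_fourierCoeffOn`) by even and odd reflection
to the circle of length `2ℓ`:

* `hasSum_sq_integral_cos_mul` — **cosine Parseval**: for continuous `f : ℝ → ℂ` and `ℓ > 0`,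
  `∑_{n ≥ 0} (c_n²/ℓ) |∫₀^ℓ cos(nπx/ℓ) f(x) dx|² = ∫₀^ℓ |f|²` (`c_0² = 1`, `c_n² = 2`), i.e.
  `∑ₙ |⟨e_n, f⟩|² = ‖f‖²` for the modes `e_n = c_n ℓ^{-1/2} cos(nπx/ℓ)` (completeness of the
  Neumann modes on the continuous functions, a dense subspace); via the even extension `f(|x|)`,
  whose Fourier coefficients on `ℝ/2ℓℤ` are `ℓ⁻¹∫₀^ℓ cos(nπx/ℓ)f`;
* `hasSum_sq_integral_sin_mul` — **sine Parseval**: `∑_{n ≥ 1} (2/ℓ)|∫₀^ℓ sin(nπx/ℓ) f|² = ∫₀^ℓ|f|²`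
  (odd extension);
* `integral_sin_mul_deriv` — `∫₀^ℓ sin(nπx/ℓ) f' = -(nπ/ℓ)∫₀^ℓ cos(nπx/ℓ) f` for `f ∈ C¹[0,ℓ]`
  (integration by parts; `sin` vanishes at both ends, so no boundary condition on `f` is needed);
* `hasSum_sq_norm_deriv` — **the Neumann form is diagonal in the cosine modes**: for `f ∈ C¹[0,ℓ]`,
  `∫₀^ℓ |f'|² = ∑_{n ≥ 0} (nπ/ℓ)² (2/ℓ)|∫₀^ℓ cos(nπx/ℓ) f|² = ∑ₙ (nπ/ℓ)² |⟨e_n, f⟩|²`.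
  In particular the Neumann Laplacian of `(0,ℓ)` has the eigenvalues `(nπ/ℓ)²` in form sense and the
  sharp gap `π²/ℓ²` on the orthogonal complement of the constants [LSSY2005, Ch. 2, after (2.50)].

Auxiliary: folding `∫_{-ℓ}^{ℓ}` onto `(0,ℓ)` (`integral_neg_ell_ell_eq`), `L²`-membership of
continuous / bounded measurable functions on bounded intervals, and the arithmetic of the characters
`fourier (-n)` of `AddCircle (2ℓ)` at `±x` (`exp_fourier_arg_eq`). No definitions (the odd extension
is a local `fun x => if 0 < x then f x else if x < 0 then -f(-x) else 0`).

## References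

* [FournaisEtAl2024] S. Fournais, L. Junge, T. Girardot, L. Morin, M. Olivieri, A. Triay,
  arXiv:2408.14222, Ann. Henri Poincaré (2026): (2.10), (2.20), §2.3.
* [LSSY2005] E. H. Lieb, R. Seiringer, J. P. Solovej, J. Yngvason, *The Mathematics of the Bose Gas
  and its Condensation*, Birkhäuser 2005: Ch. 2, after (2.50).
-/

noncomputable section

open Real intervalIntegral MeasureTheory Set Filter Topology Complex

namespace Literature.MathematicalPhysics.QuantumManyBody.NeumannBox

variable {E : Type*} [NormedAddCommGroup E] [NormedSpace ℝ E]

/-! ### Auxiliary integrals -/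

/-- Folding an integral over `(-ℓ, ℓ)` onto `(0, ℓ)`: `∫_{-ℓ}^{ℓ} φ = ∫₀^ℓ (φ(x) + φ(-x)) dx`
(integrable version). [folklore] -/
theorem integral_neg_ell_ell_eq_of_integrable {ℓ : ℝ} {φ : ℝ → E}
    (h1 : IntervalIntegrable φ volume (-ℓ) 0) (h2 : IntervalIntegrable φ volume 0 ℓ)
    (h4 : IntervalIntegrable (fun x => φ (-x)) volume 0 ℓ) :
    ∫ x in (-ℓ)..ℓ, φ x = ∫ x in (0 : ℝ)..ℓ, (φ x + φ (-x)) := by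
  rw [← integral_add_adjacent_intervals h1 h2]
  have h3 : ∫ x in (-ℓ)..0, φ x = ∫ x in (0 : ℝ)..ℓ, φ (-x) := by
    rw [intervalIntegral.integral_comp_neg]; simp
  rw [h3, add_comm]
  exact (intervalIntegral.integral_add h2 h4).symm

/-- Folding an integral over `(-ℓ, ℓ)` onto `(0, ℓ)`, continuous version. [folklore] -/
theorem integral_neg_ell_ell_eq {ℓ : ℝ} {φ : ℝ → E} (hφ : Continuous φ) :
    ∫ x in (-ℓ)..ℓ, φ x = ∫ x in (0 : ℝ)..ℓ, (φ x + φ (-x)) :=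
  integral_neg_ell_ell_eq_of_integrable (hφ.intervalIntegrable _ _) (hφ.intervalIntegrable _ _)
    ((hφ.comp continuous_neg).intervalIntegrable _ _)

/-- A continuous function is in `L²` of a bounded interval. [folklore] -/
theorem memLp_two_Ioc_of_continuous {a b : ℝ} {F : ℝ → ℂ} (hF : Continuous F) :
    MemLp F 2 (volume.restrict (Ioc a b)) := by
  obtain ⟨C, hC⟩ := (isCompact_Icc (a := a) (b := b)).exists_bound_of_continuousOn hF.continuousOn
  have htop : MemLp F ⊤ (volume.restrict (Ioc a b)) :=
    memLp_top_of_bound hF.aestronglyMeasurable C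
      (ae_restrict_of_forall_mem measurableSet_Ioc fun x hx => hC x (Ioc_subset_Icc_self hx))
  exact htop.mono_exponent le_top

/-- A measurable function bounded on `Ι a b` is interval integrable. [folklore] -/
theorem intervalIntegrable_of_norm_le {G : Type*} [NormedAddCommGroup G] {φ : ℝ → G} {a b M : ℝ}
    (hφ : AEStronglyMeasurable φ (volume.restrict (uIoc a b)))
    (hM : ∀ x ∈ uIoc a b, ‖φ x‖ ≤ M) : IntervalIntegrable φ volume a b := by
  refine IntervalIntegrable.mono_fun' (g := fun _ => M) intervalIntegrable_const hφ ?_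
  rw [Filter.EventuallyLE, ae_restrict_iff' measurableSet_uIoc]
  exact Filter.Eventually.of_forall hM

/-- `Ι a b ⊆ [-max(|a|,|b|), max(|a|,|b|)]`. [folklore] -/
theorem mem_Icc_of_mem_uIoc {a b x : ℝ} (hx : x ∈ uIoc a b) :
    x ∈ Icc (-(max |a| |b|)) (max |a| |b|) := by
  have hx' : x ∈ uIcc a b := uIoc_subset_uIcc hx
  rw [mem_uIcc] at hx'
  constructor <;>
  · rcases hx' with h | h <;>
      nlinarith [le_abs_self a, neg_abs_le a, le_abs_self b, neg_abs_le b,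
        le_max_left |a| |b|, le_max_right |a| |b|]

/-- The characters of `ℝ/2ℓℤ` at the Neumann wave numbers:
`exp(2πi(-n)x/(2ℓ)) = exp(-i·(nπx/ℓ))`. [folklore] -/
theorem exp_fourier_arg_eq {ℓ : ℝ} (hℓ : ℓ ≠ 0) (i : ℤ) (x : ℝ) :
    Complex.exp (2 * π * I * ((-i : ℤ) : ℂ) * (x : ℂ) / ((2 * ℓ : ℝ) : ℂ)) =
      Complex.exp (-((i * π / ℓ * x : ℝ) : ℂ) * I) := by
  congr 1
  have : ((2 * ℓ : ℝ) : ℂ) ≠ 0 := by exact_mod_cast (mul_ne_zero two_ne_zero hℓ)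
  have hℓ' : (ℓ : ℂ) ≠ 0 := by exact_mod_cast hℓ
  push_cast
  field_simp

/-! ### The cosine Parseval identity (even reflection) -/

/-- **Parseval for the Neumann cosine modes of `(0, ℓ)`.** For `ℓ > 0` and continuous `f : ℝ → ℂ`,
`∑_{n ≥ 0} (c_n²/ℓ)|∫₀^ℓ cos(nπx/ℓ) f(x) dx|² = ∫₀^ℓ |f(x)|² dx` with `c_0² = 1`, `c_n² = 2`
(`n ≥ 1`): the system `c_n ℓ^{-1/2}cos(nπx/ℓ)` is complete. Proof: Parseval on `ℝ/2ℓℤ` for the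
even extension `x ↦ f(|x|)`, whose `n`-th Fourier coefficient is `ℓ⁻¹∫₀^ℓ cos(nπx/ℓ) f`, and
folding the sum over `ℤ` onto `ℕ`. [folklore] -/
theorem hasSum_sq_integral_cos_mul {ℓ : ℝ} (hℓ : 0 < ℓ) {f : ℝ → ℂ} (hf : Continuous f) :
    HasSum (fun n : ℕ => (if n = 0 then 1 else 2) / ℓ *
        ‖∫ x in (0 : ℝ)..ℓ, (Real.cos (n * π / ℓ * x) : ℂ) * f x‖ ^ 2)
      (∫ x in (0 : ℝ)..ℓ, ‖f x‖ ^ 2) := by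
  have hab : -ℓ < ℓ := by linarith
  have h2ℓ : ℓ - -ℓ = 2 * ℓ := by ring
  have hℓ0 : ℓ ≠ 0 := hℓ.ne'
  set F : ℝ → ℂ := fun x => f |x| with hF
  have hFc : Continuous F := hf.comp continuous_abs
  have hL2 : MemLp F 2 (volume.restrict (Ioc (-ℓ) ℓ)) := memLp_two_Ioc_of_continuous hFc
  have hpars := hasSum_sq_fourierCoeffOn hab hL2
  set C : ℤ → ℂ := fun i => ∫ x in (0 : ℝ)..ℓ, (Real.cos (i * π / ℓ * x) : ℂ) * f x with hC
  -- the Fourier coefficients of the even extension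
  have hcoef : ∀ i : ℤ, fourierCoeffOn hab F i = ((1 / ℓ : ℝ) : ℂ) * C i := by
    intro i
    rw [fourierCoeffOn_eq_integral, h2ℓ]
    have hφc : Continuous fun x : ℝ => fourier (-i) (x : AddCircle (2 * ℓ)) • F x :=
      ((fourier (-i)).continuous.comp (AddCircle.continuous_mk' (2 * ℓ))).smul hFc
    rw [integral_neg_ell_ell_eq hφc]
    have hsum : ∀ x ∈ uIcc (0 : ℝ) ℓ,
        fourier (-i) (x : AddCircle (2 * ℓ)) • F x +
            fourier (-i) ((-x : ℝ) : AddCircle (2 * ℓ)) • F (-x) =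
          2 * ((Real.cos (i * π / ℓ * x) : ℂ) * f x) := by
      intro x hx
      rw [uIcc_of_le hℓ.le] at hx
      have hx0 : 0 ≤ x := hx.1
      have he1 : fourier (-i) (x : AddCircle (2 * ℓ)) =
          Complex.exp (-((i * π / ℓ * x : ℝ) : ℂ) * I) := by
        rw [fourier_coe_apply]; exact exp_fourier_arg_eq hℓ0 i x
      have he2 : fourier (-i) ((-x : ℝ) : AddCircle (2 * ℓ)) =
          Complex.exp (((i * π / ℓ * x : ℝ) : ℂ) * I) := by
        rw [fourier_coe_apply, exp_fourier_arg_eq hℓ0 i (-x)]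
        congr 1; push_cast; ring
      simp only [hF, abs_neg, abs_of_nonneg hx0, smul_eq_mul, he1, he2]
      rw [← add_mul, Complex.ofReal_cos, ← mul_assoc, Complex.two_cos, add_comm]
    rw [intervalIntegral.integral_congr hsum, intervalIntegral.integral_const_mul, hC]
    simp only [Complex.real_smul]
    push_cast
    field_simp
  -- norms of the coefficients
  have hnorm : ∀ i : ℤ, ‖fourierCoeffOn hab F i‖ ^ 2 = ‖C i‖ ^ 2 / ℓ ^ 2 := by
    intro i
    rw [hcoef, norm_mul, Complex.norm_real, Real.norm_eq_abs, abs_of_pos (by positivity),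
      mul_pow]
    field_simp
  -- the right-hand side of Parseval
  have hrhs : (ℓ - -ℓ)⁻¹ • ∫ x in (-ℓ)..ℓ, ‖F x‖ ^ 2 = ℓ⁻¹ * ∫ x in (0 : ℝ)..ℓ, ‖f x‖ ^ 2 := by
    have hc2 : Continuous fun x => ‖F x‖ ^ 2 := by fun_prop
    rw [h2ℓ, integral_neg_ell_ell_eq hc2]
    have h2 : ∀ x ∈ uIcc (0 : ℝ) ℓ, ‖F x‖ ^ 2 + ‖F (-x)‖ ^ 2 = 2 * ‖f x‖ ^ 2 := by
      intro x hx
      rw [uIcc_of_le hℓ.le] at hx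
      simp only [hF, abs_neg, abs_of_nonneg hx.1]
      ring
    rw [intervalIntegral.integral_congr h2, intervalIntegral.integral_const_mul, smul_eq_mul]
    field_simp
  rw [hrhs] at hpars
  simp_rw [hnorm] at hpars
  have hg : HasSum (fun i : ℤ => ‖C i‖ ^ 2 / ℓ) (∫ x in (0 : ℝ)..ℓ, ‖f x‖ ^ 2) := by
    have h := hpars.mul_left ℓ
    have h1 : (fun i : ℤ => ℓ * (‖C i‖ ^ 2 / ℓ ^ 2)) = fun i => ‖C i‖ ^ 2 / ℓ := by
      funext i; field_simp
    have h2 : ℓ * (ℓ⁻¹ * ∫ x in (0 : ℝ)..ℓ, ‖f x‖ ^ 2) = ∫ x in (0 : ℝ)..ℓ, ‖f x‖ ^ 2 := by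
      field_simp
    rwa [h1, h2] at h
  -- evenness of the cosine transform, and folding `ℤ` onto `ℕ`
  have heven : ∀ i : ℤ, C (-i) = C i := by
    intro i
    simp only [hC, Int.cast_neg, neg_mul, neg_div, Real.cos_neg]
  have hnat := hg.nat_add_neg
  have h2g : HasSum (fun n : ℕ => 2 * (‖C n‖ ^ 2 / ℓ))
      ((∫ x in (0 : ℝ)..ℓ, ‖f x‖ ^ 2) + ‖C 0‖ ^ 2 / ℓ) := by
    convert hnat using 2 with n
    rw [heven]; ring
  have hupd := h2g.update 0 (‖C 0‖ ^ 2 / ℓ)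
  have hfun : Function.update (fun n : ℕ => 2 * (‖C n‖ ^ 2 / ℓ)) 0 (‖C 0‖ ^ 2 / ℓ) =
      fun n : ℕ => (if n = 0 then 1 else 2) / ℓ *
        ‖∫ x in (0 : ℝ)..ℓ, (Real.cos (n * π / ℓ * x) : ℂ) * f x‖ ^ 2 := by
    funext n
    rcases eq_or_ne n 0 with rfl | hn
    · simp only [Function.update_self, if_true, hC, Nat.cast_zero, Int.cast_zero, zero_mul,
        zero_div]
      ring
    · rw [Function.update_of_ne hn, if_neg hn, hC]
      simp only [Int.cast_natCast]
      ring
  have hval : ‖C 0‖ ^ 2 / ℓ - 2 * (‖C ((0 : ℕ) : ℤ)‖ ^ 2 / ℓ) +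
      ((∫ x in (0 : ℝ)..ℓ, ‖f x‖ ^ 2) + ‖C 0‖ ^ 2 / ℓ) = ∫ x in (0 : ℝ)..ℓ, ‖f x‖ ^ 2 := by
    push_cast
    ring
  rw [hfun, hval] at hupd
  exact hupd

/-! ### The sine Parseval identity (odd reflection) -/

/-- **Parseval for the sine modes of `(0, ℓ)`.** For `ℓ > 0` and continuous `f : ℝ → ℂ`,
`∑_{n ≥ 0} (2/ℓ)|∫₀^ℓ sin(nπx/ℓ) f(x) dx|² = ∫₀^ℓ |f(x)|² dx` (the `n = 0` term vanishes):
Parseval on `ℝ/2ℓℤ` for the odd extension, whose `n`-th Fourier coefficient is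
`-iℓ⁻¹∫₀^ℓ sin(nπx/ℓ) f`. [folklore] -/
theorem hasSum_sq_integral_sin_mul {ℓ : ℝ} (hℓ : 0 < ℓ) {f : ℝ → ℂ} (hf : Continuous f) :
    HasSum (fun n : ℕ => 2 / ℓ * ‖∫ x in (0 : ℝ)..ℓ, (Real.sin (n * π / ℓ * x) : ℂ) * f x‖ ^ 2)
      (∫ x in (0 : ℝ)..ℓ, ‖f x‖ ^ 2) := by
  have hab : -ℓ < ℓ := by linarith
  have h2ℓ : ℓ - -ℓ = 2 * ℓ := by ring
  have hℓ0 : ℓ ≠ 0 := hℓ.ne'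
  -- the odd extension and its elementary properties
  set F : ℝ → ℂ := fun x => if 0 < x then f x else if x < 0 then -f (-x) else 0 with hF
  have hFpos : ∀ {x : ℝ}, 0 < x → F x = f x := fun hx => by simp [hF, hx]
  have hFneg : ∀ {x : ℝ}, 0 < x → F (-x) = -f x := fun {x} hx => by
    have h1 : ¬ (0 < -x) := by linarith
    have h2 : -x < 0 := by linarith
    simp [hF, h1, h2]
  have hF0 : F 0 = 0 := by simp [hF]
  have hFm : Measurable F := by
    refine Measurable.ite (measurableSet_lt measurable_const measurable_id) hf.measurable ?_
    exact Measurable.ite (measurableSet_lt measurable_id measurable_const)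
      (hf.measurable.comp measurable_neg).neg measurable_const
  have hFbd : ∀ R : ℝ, ∃ M : ℝ, ∀ x ∈ Icc (-R) R, ‖F x‖ ≤ M := by
    intro R
    obtain ⟨C, hC⟩ := (isCompact_Icc (a := (0 : ℝ)) (b := R)).exists_bound_of_continuousOn
      hf.continuousOn
    refine ⟨max C 0, fun x hx => ?_⟩
    simp only [hF]
    split_ifs with h1 h2
    · exact (hC x ⟨h1.le, hx.2⟩).trans (le_max_left _ _)
    · rw [norm_neg]
      exact (hC (-x) ⟨by linarith, by linarith [hx.1]⟩).trans (le_max_left _ _)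
    · simp
  have hFint : ∀ {g : ℝ → ℂ}, Continuous g → ∀ a b : ℝ,
      IntervalIntegrable (fun x => g x * F x) volume a b := by
    intro g hg a b
    obtain ⟨M, hM⟩ := hFbd (max |a| |b|)
    obtain ⟨D, hD⟩ := (isCompact_uIcc (a := a) (b := b)).exists_bound_of_continuousOn hg.continuousOn
    have hM0 : 0 ≤ M := (norm_nonneg _).trans (hM 0 ⟨by simp, by positivity⟩)
    refine intervalIntegrable_of_norm_le ((hg.measurable.mul hFm).aestronglyMeasurable)
      (M := max D 0 * M) fun x hx => ?_
    rw [norm_mul]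
    exact mul_le_mul ((hD x (uIoc_subset_uIcc hx)).trans (le_max_left _ _))
      (hM x (mem_Icc_of_mem_uIoc hx)) (norm_nonneg _) (le_max_right _ _)
  have hFsq : ∀ a b : ℝ, IntervalIntegrable (fun x => ‖F x‖ ^ 2) volume a b := by
    intro a b
    obtain ⟨M, hM⟩ := hFbd (max |a| |b|)
    refine intervalIntegrable_of_norm_le ((hFm.norm.pow_const 2).aestronglyMeasurable)
      (M := M ^ 2) fun x hx => ?_
    rw [Real.norm_eq_abs, abs_of_nonneg (sq_nonneg _)]
    exact pow_le_pow_left₀ (norm_nonneg _) (hM x (mem_Icc_of_mem_uIoc hx)) 2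
  -- Parseval on the circle
  have hL2 : MemLp F 2 (volume.restrict (Ioc (-ℓ) ℓ)) := by
    obtain ⟨M, hM⟩ := hFbd ℓ
    have htop : MemLp F ⊤ (volume.restrict (Ioc (-ℓ) ℓ)) :=
      memLp_top_of_bound hFm.aestronglyMeasurable M
        (ae_restrict_of_forall_mem measurableSet_Ioc fun x hx => hM x (Ioc_subset_Icc_self hx))
    exact htop.mono_exponent le_top
  have hpars := hasSum_sq_fourierCoeffOn hab hL2
  set S : ℤ → ℂ := fun i => ∫ x in (0 : ℝ)..ℓ, (Real.sin (i * π / ℓ * x) : ℂ) * f x with hS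
  -- the Fourier coefficients of the odd extension
  have hcoef : ∀ i : ℤ, fourierCoeffOn hab F i = -(Complex.I * ((1 / ℓ : ℝ) : ℂ)) * S i := by
    intro i
    rw [fourierCoeffOn_eq_integral, h2ℓ]
    have hgc : Continuous fun x : ℝ => fourier (-i) (x : AddCircle (2 * ℓ)) :=
      (fourier (-i)).continuous.comp (AddCircle.continuous_mk' (2 * ℓ))
    have hI : ∀ a b : ℝ, IntervalIntegrable
        (fun x : ℝ => fourier (-i) (x : AddCircle (2 * ℓ)) • F x) volume a b := fun a b => by
      simp_rw [smul_eq_mul]; exact hFint hgc a b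
    have hI' : IntervalIntegrable
        (fun x : ℝ => fourier (-i) ((-x : ℝ) : AddCircle (2 * ℓ)) • F (-x)) volume 0 ℓ := by
      have := (IntervalIntegrable.iff_comp_neg (by finiteness)).1 (hI 0 (-ℓ))
      simpa using this
    rw [integral_neg_ell_ell_eq_of_integrable (hI _ _) (hI _ _) hI']
    have hsum : ∀ x ∈ uIcc (0 : ℝ) ℓ,
        fourier (-i) (x : AddCircle (2 * ℓ)) • F x +
            fourier (-i) ((-x : ℝ) : AddCircle (2 * ℓ)) • F (-x) =
          -(2 * Complex.I) * ((Real.sin (i * π / ℓ * x) : ℂ) * f x) := by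
      intro x hx
      rw [uIcc_of_le hℓ.le] at hx
      rcases hx.1.eq_or_lt with hx0 | hx0
      · subst hx0
        simp [hF0]
      have he1 : fourier (-i) (x : AddCircle (2 * ℓ)) =
          Complex.exp (-((i * π / ℓ * x : ℝ) : ℂ) * I) := by
        rw [fourier_coe_apply]; exact exp_fourier_arg_eq hℓ0 i x
      have he2 : fourier (-i) ((-x : ℝ) : AddCircle (2 * ℓ)) =
          Complex.exp (((i * π / ℓ * x : ℝ) : ℂ) * I) := by
        rw [fourier_coe_apply, exp_fourier_arg_eq hℓ0 i (-x)]
        congr 1; push_cast; ring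
      simp only [hFpos hx0, hFneg hx0, smul_eq_mul, he1, he2]
      rw [Complex.ofReal_sin, Complex.sin]
      ring_nf
      rw [Complex.I_sq]
      ring
    rw [intervalIntegral.integral_congr hsum, intervalIntegral.integral_const_mul, hS]
    simp only [Complex.real_smul]
    push_cast
    field_simp
  -- norms of the coefficients
  have hnorm : ∀ i : ℤ, ‖fourierCoeffOn hab F i‖ ^ 2 = ‖S i‖ ^ 2 / ℓ ^ 2 := by
    intro i
    rw [hcoef, norm_mul, norm_neg, norm_mul, Complex.norm_I, one_mul, Complex.norm_real,
      Real.norm_eq_abs, abs_of_pos (by positivity), mul_pow]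
    field_simp
  -- the right-hand side of Parseval
  have hFsq' : IntervalIntegrable (fun x => ‖F (-x)‖ ^ 2) volume 0 ℓ := by
    have := (IntervalIntegrable.iff_comp_neg (by finiteness)).1 (hFsq 0 (-ℓ))
    simpa using this
  have hrhs : (ℓ - -ℓ)⁻¹ • ∫ x in (-ℓ)..ℓ, ‖F x‖ ^ 2 = ℓ⁻¹ * ∫ x in (0 : ℝ)..ℓ, ‖f x‖ ^ 2 := by
    rw [h2ℓ, integral_neg_ell_ell_eq_of_integrable (hFsq _ _) (hFsq _ _) hFsq']
    have h2 : ∀ᵐ x ∂volume, x ∈ uIoc (0 : ℝ) ℓ → ‖F x‖ ^ 2 + ‖F (-x)‖ ^ 2 = 2 * ‖f x‖ ^ 2 := by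
      refine Filter.Eventually.of_forall fun x hx => ?_
      rw [uIoc_of_le hℓ.le] at hx
      simp only [hFpos hx.1, hFneg hx.1, norm_neg]
      ring
    rw [intervalIntegral.integral_congr_ae h2, intervalIntegral.integral_const_mul, smul_eq_mul]
    field_simp
  rw [hrhs] at hpars
  simp_rw [hnorm] at hpars
  have hg : HasSum (fun i : ℤ => ‖S i‖ ^ 2 / ℓ) (∫ x in (0 : ℝ)..ℓ, ‖f x‖ ^ 2) := by
    have h := hpars.mul_left ℓ
    have h1 : (fun i : ℤ => ℓ * (‖S i‖ ^ 2 / ℓ ^ 2)) = fun i => ‖S i‖ ^ 2 / ℓ := by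
      funext i; field_simp
    have h2 : ℓ * (ℓ⁻¹ * ∫ x in (0 : ℝ)..ℓ, ‖f x‖ ^ 2) = ∫ x in (0 : ℝ)..ℓ, ‖f x‖ ^ 2 := by
      field_simp
    rwa [h1, h2] at h
  -- oddness of the sine transform, `S 0 = 0`, and folding `ℤ` onto `ℕ`
  have hodd : ∀ i : ℤ, ‖S (-i)‖ = ‖S i‖ := by
    intro i
    have : S (-i) = -S i := by
      simp only [hS, Int.cast_neg, neg_mul, neg_div, Real.sin_neg, Complex.ofReal_neg, neg_mul,
        intervalIntegral.integral_neg]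
    rw [this, norm_neg]
  have hS0 : S 0 = 0 := by simp [hS]
  have hnat := hg.nat_add_neg
  rw [hS0, norm_zero, zero_pow two_ne_zero, zero_div, add_zero] at hnat
  have hfun : (fun n : ℕ => ‖S n‖ ^ 2 / ℓ + ‖S (-n)‖ ^ 2 / ℓ) =
      fun n : ℕ => 2 / ℓ * ‖∫ x in (0 : ℝ)..ℓ, (Real.sin (n * π / ℓ * x) : ℂ) * f x‖ ^ 2 := by
    funext n
    rw [hodd, hS]
    simp only [Int.cast_natCast]
    ring
  rw [hfun] at hnat
  exact hnat

/-! ### The Neumann form is diagonal in the cosine modes -/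

/-- **Integration by parts without boundary terms**: for `f ∈ C¹[0, ℓ]` (derivative `f'` on
`[0,ℓ]`, continuous) and `n ≥ 0`, `∫₀^ℓ sin(nπx/ℓ) f'(x) dx = -(nπ/ℓ) ∫₀^ℓ cos(nπx/ℓ) f(x) dx`
(`sin` vanishes at `0` and at `ℓ`, so no boundary condition on `f` is needed). [folklore] -/
theorem integral_sin_mul_deriv {ℓ : ℝ} (hℓ : 0 < ℓ) (n : ℕ) {f f' : ℝ → ℂ}
    (hf : ∀ x ∈ uIcc (0 : ℝ) ℓ, HasDerivAt f (f' x) x) (hf' : Continuous f') :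
    ∫ x in (0 : ℝ)..ℓ, (Real.sin (n * π / ℓ * x) : ℂ) * f' x =
      -((n * π / ℓ : ℝ) : ℂ) * ∫ x in (0 : ℝ)..ℓ, (Real.cos (n * π / ℓ * x) : ℂ) * f x := by
  set k : ℝ := n * π / ℓ with hk
  have hu : ∀ x ∈ uIcc (0 : ℝ) ℓ, HasDerivAt (fun y : ℝ => (Real.sin (k * y) : ℂ))
      (((k * Real.cos (k * x) : ℝ) : ℂ)) x := by
    intro x _
    have h1 : HasDerivAt (fun y : ℝ => k * y) k x := by
      simpa using (hasDerivAt_id x).const_mul k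
    have h2 : HasDerivAt (fun y : ℝ => Real.sin (k * y)) (Real.cos (k * x) * k) x := h1.sin
    refine h2.ofReal_comp.congr_deriv ?_
    push_cast; ring
  have hu'int : IntervalIntegrable (fun x => (((k * Real.cos (k * x) : ℝ) : ℂ))) volume 0 ℓ :=
    (Continuous.intervalIntegrable (by fun_prop) _ _)
  have hv'int : IntervalIntegrable f' volume 0 ℓ := hf'.intervalIntegrable _ _
  rw [intervalIntegral.integral_mul_deriv_eq_deriv_mul hu hf hu'int hv'int]
  have hkℓ : k * ℓ = n * π := by rw [hk]; field_simp
  simp only [mul_zero, Real.sin_zero, Complex.ofReal_zero, zero_mul, sub_zero, hkℓ,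
    Real.sin_nat_mul_pi, zero_sub, ← intervalIntegral.integral_neg,
    ← intervalIntegral.integral_const_mul]
  congr 1
  funext x
  push_cast
  ring

/-- **The Neumann form `∫₀^ℓ |f'|²` is diagonal in the cosine modes, with eigenvalues `(nπ/ℓ)²`,
for every `f ∈ C¹[0,ℓ]` (no boundary condition).** For `ℓ > 0`, `f` with a continuous derivative
`f'` on `[0, ℓ]`:
`∑_{n ≥ 0} (nπ/ℓ)² (2/ℓ)|∫₀^ℓ cos(nπx/ℓ) f|² = ∫₀^ℓ |f'|²`, i.e.
`∫₀^ℓ|f'|² = ∑ₙ (nπ/ℓ)²|⟨e_n, f⟩|²` for the normalised Neumann modes `e_n` (sine Parseval for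
`f'` and `integral_sin_mul_deriv`). Consequently `-d²/dx²` with Neumann conditions on `(0,ℓ)` has
form-spectrum `{(nπ/ℓ)²}` and the gap `π²/ℓ²` above the constants.
[cite: LSSY2005, Ch. 2, after (2.50)] -/
theorem hasSum_sq_norm_deriv {ℓ : ℝ} (hℓ : 0 < ℓ) {f f' : ℝ → ℂ}
    (hf : ∀ x ∈ uIcc (0 : ℝ) ℓ, HasDerivAt f (f' x) x) (hf' : Continuous f') :
    HasSum (fun n : ℕ => 2 / ℓ * (n * π / ℓ) ^ 2 *
        ‖∫ x in (0 : ℝ)..ℓ, (Real.cos (n * π / ℓ * x) : ℂ) * f x‖ ^ 2)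
      (∫ x in (0 : ℝ)..ℓ, ‖f' x‖ ^ 2) := by
  have h := hasSum_sq_integral_sin_mul hℓ hf'
  have hfun : (fun n : ℕ => 2 / ℓ *
      ‖∫ x in (0 : ℝ)..ℓ, (Real.sin (n * π / ℓ * x) : ℂ) * f' x‖ ^ 2) =
      fun n : ℕ => 2 / ℓ * (n * π / ℓ) ^ 2 *
        ‖∫ x in (0 : ℝ)..ℓ, (Real.cos (n * π / ℓ * x) : ℂ) * f x‖ ^ 2 := by
    funext n
    rw [integral_sin_mul_deriv hℓ n hf hf', norm_mul, norm_neg, Complex.norm_real,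
      Real.norm_eq_abs, mul_pow, sq_abs]
    ring
  rwa [hfun] at h

/-- **The sharp Neumann gap as a corollary (Bessel form)**: for `f ∈ C¹[0,ℓ]`,
`(π/ℓ)² ∑_{n ≥ 1} (2/ℓ)|∫₀^ℓ cos(nπx/ℓ) f|² ≤ ∫₀^ℓ |f'|²` — each `n ≥ 1` term of the cosine
Parseval sum of `f` (the non-constant part `‖f - ⟨f⟩‖²`) is dominated by `(ℓ/π)²` times the
corresponding term of `∫|f'|²`. [cite: LSSY2005, Ch. 2, after (2.50)] -/
theorem sq_pi_div_mul_tsum_le_integral_sq_norm_deriv {ℓ : ℝ} (hℓ : 0 < ℓ) {f f' : ℝ → ℂ}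
    (hf : ∀ x ∈ uIcc (0 : ℝ) ℓ, HasDerivAt f (f' x) x) (hf' : Continuous f') :
    (π / ℓ) ^ 2 * ∑' n : ℕ, (if n = 0 then 0 else
        2 / ℓ * ‖∫ x in (0 : ℝ)..ℓ, (Real.cos (n * π / ℓ * x) : ℂ) * f x‖ ^ 2) ≤
      ∫ x in (0 : ℝ)..ℓ, ‖f' x‖ ^ 2 := by
  have h := hasSum_sq_norm_deriv hℓ hf hf'
  have hle : ∀ n : ℕ, (π / ℓ) ^ 2 * (if n = 0 then 0 else
      2 / ℓ * ‖∫ x in (0 : ℝ)..ℓ, (Real.cos (n * π / ℓ * x) : ℂ) * f x‖ ^ 2) ≤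
      2 / ℓ * (n * π / ℓ) ^ 2 * ‖∫ x in (0 : ℝ)..ℓ, (Real.cos (n * π / ℓ * x) : ℂ) * f x‖ ^ 2 := by
    intro n
    rcases eq_or_ne n 0 with rfl | hn
    · simp
    · rw [if_neg hn]
      have hn1 : (1 : ℝ) ≤ n := by exact_mod_cast Nat.one_le_iff_ne_zero.2 hn
      have hI : 0 ≤ 2 / ℓ * ‖∫ x in (0 : ℝ)..ℓ, (Real.cos (n * π / ℓ * x) : ℂ) * f x‖ ^ 2 := by
        positivity
      have hk : (π / ℓ) ^ 2 ≤ (n * π / ℓ) ^ 2 := by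
        rw [show (n * π / ℓ) = n * (π / ℓ) by ring, mul_pow]
        nlinarith [sq_nonneg (π / ℓ), one_le_pow₀ (n := 2) hn1]
      nlinarith
  have hpi : 0 < π / ℓ := by positivity
  have hsum : Summable fun n : ℕ => (if n = 0 then 0 else
      2 / ℓ * ‖∫ x in (0 : ℝ)..ℓ, (Real.cos (n * π / ℓ * x) : ℂ) * f x‖ ^ 2) := by
    refine Summable.of_nonneg_of_le (fun n => by positivity) (fun n => ?_)
      ((h.summable).mul_left ((ℓ / π) ^ 2))
    have key : (if n = 0 then 0 else
        2 / ℓ * ‖∫ x in (0 : ℝ)..ℓ, (Real.cos (n * π / ℓ * x) : ℂ) * f x‖ ^ 2) =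
        (ℓ / π) ^ 2 * ((π / ℓ) ^ 2 * (if n = 0 then 0 else
          2 / ℓ * ‖∫ x in (0 : ℝ)..ℓ, (Real.cos (n * π / ℓ * x) : ℂ) * f x‖ ^ 2)) := by
      rw [← mul_assoc, show (ℓ / π) ^ 2 * (π / ℓ) ^ 2 = 1 by field_simp, one_mul]
    rw [key]
    exact mul_le_mul_of_nonneg_left (hle n) (by positivity)
  rw [← tsum_mul_left, ← h.tsum_eq]
  exact Summable.tsum_le_tsum hle (hsum.mul_left _) h.summable

end Literature.MathematicalPhysics.QuantumManyBody.NeumannBox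

end
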